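import Mathlib
import Summits.CriticalPhenomena.CardyFormulaZ2.Theorems.CardyMagicRigidityNestingRigidityTreeRigidityTameAssembly
import HarnessLib

/-!
# Stub `treeRigidityTame_of_tameRigidity`, generic-class form: any INTERIOR-RIGID support class closes the assembly

Crux `Summit.CriticalPhenomena.CardyFormulaZ2.Theses.CardyMagicRigidity.NestingRigidity`
(stmt-CriticalPhenomena-4835), line `positive-cone-weight-doubling`, registered helper
`treeRigidityTame_of_tameRigidity` (vocabulary of `Theorems/CardyMagicRigidityPositiveConeJointDefs.lean`,
p130599).  Its tame rigidity hypothesis is reported refuted (two-mouth lake), so the support class of the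
limits will have to be repaired.  This file states the rigidity-dependent end of the assembly for an
ARBITRARY interior-rigid class `𝒞` of loops —

  `∀ u ∈ 𝒞, ∀ v ∈ 𝒞, {z | W(u, z) ≠ 0} = {z | W(v, z) ≠ 0} → d(u, v) = 0`

(written inline; e.g. any reversal-closed single-signed winding-injective class on its degree-one part,
`udist_eq_zero_of_windInjective`, p128704; simple loops with the boundary property,
`udist_eq_zero_of_simpleLoop_of_interior_eq`) — so that a repaired route only has to supply the class:

* `isClose_of_interiorRigid_of_typedCounts_eq` — configuration level: two `Regular` configurations carried
  by `𝒞` with equal typed two-disc pattern counts at positive rational data are `ε`-close for every `ε ≥ 0`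
  (`typedCounts_one_disc_of_typedCounts_eq` / `typedCounts_two_disc_of_typedCounts_eq`, p132016, into
  `isClose_of_typedCounts_eq`, p130005).
* `cnLawEDist_eq_zero_of_interiorRigid_of_typedCylinders_eq` (registered anchor) — law level: two
  presentations on `([0,1], Leb)` with a.e. `Regular` values carried by `𝒞`, measurable typed counts and
  equal joint typed cylinder probabilities at positive rational data are at `d_CN = 0` (coupling with a.s.
  equal typed counts, `exists_coupling_typedCounts_eq_of_typedCylinders_eq`, p132016; a.s.-close couplings
  witness distance `0`, `cnLawEDist_eq_zero_of_coupling`, p131483).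
* `treeRigidity_of_interiorRigid_of_cylinderLimits` (registered anchor) — the whole assembly for the class
  `𝒞`, conditional on the convergence of the lattice typed cylinder probabilities to those of the limits
  (step (1a); `measure_typedCylinder_rat_eq_of_cylinderLimits`, p132337) and glued by
  `tendsto_cnLawEDist_zEns_tEns_of_limits` (p131483).
-/

noncomputable section

open MeasureTheory Set Filter Metric
open scoped Real Topology BigOperators ENNReal

namespace Summit.CriticalPhenomena.CardyFormulaZ2.Cruxes.NestingRigidity.PositiveConeWeightDoubling

open Literature.Probability.RandomPlanarGeometry Literature.Probability.Percolation
  Literature.Probability.LatticeModels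
open Summit.CriticalPhenomena.CardyFormulaZ2.Theses.CardyMagicRigidity
open Summit.CriticalPhenomena.CardyFormulaZ2.Cruxes.NestingRigidity.RingCloudTomography

/-- **Configuration level: on an interior-rigid class, equal typed counts at rational data give
`d_CN ≤ ε` for every `ε ≥ 0`.** -/
theorem isClose_of_interiorRigid_of_typedCounts_eq {𝒞 : Set (UnbasedLoop ℂ)}
    (h𝒞 : ∀ u ∈ 𝒞, ∀ v ∈ 𝒞, {z | u.wind z ≠ 0} = {z | v.wind z ≠ 0} → u.udist v = 0)
    {c c' : LoopConfig ℂ} (hc : Regular c) (hc' : Regular c') (hsub : c.loops ⊆ 𝒞)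
    (hsub' : c'.loops ⊆ 𝒞)
    (h : ∀ (i : Fin 2) (x : Fin 2 → ℚ × ℚ) (r : Fin 2 → ℚ) (R : ℚ) (S : Finset (Fin 2)),
      (∀ j, 0 < r j) → S.Nonempty →
      typedPatternCount c i (fun j ↦ (⟨(x j).1, (x j).2⟩ : ℂ)) (fun j ↦ (r j : ℝ)) R S =
        typedPatternCount c' i (fun j ↦ (⟨(x j).1, (x j).2⟩ : ℂ)) (fun j ↦ (r j : ℝ)) R S)
    (ε : ℝ) (hε : 0 ≤ ε) : LoopConfig.IsClose ε c c' :=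
  isClose_of_typedCounts_eq h𝒞 hc hc' hsub hsub' (typedCounts_one_disc_of_typedCounts_eq hc hc' h)
    (fun i R q q' s s' hs hs' _ ↦ typedCounts_two_disc_of_typedCounts_eq hc hc' h i R q q' s s' hs hs')
    ε hε

/-- **Law level: on an interior-rigid class, equal joint typed cylinder probabilities give `d_CN = 0`
(registered anchor).**  Let `𝒞` be interior-rigid and let `X, X'` be presentations on `([0,1], Leb)` with
a.e. `Regular` values all of whose loops lie in `𝒞`, with measurable typed pattern counts, whose joint typed
cylinder probabilities at positive rational data agree.  Then `d_CN((Leb, X), (Leb, X')) = 0`. -/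
theorem cnLawEDist_eq_zero_of_interiorRigid_of_typedCylinders_eq : ∀ {𝒞 : Set (UnbasedLoop ℂ)},
    (∀ u ∈ 𝒞, ∀ v ∈ 𝒞, {z | u.wind z ≠ 0} = {z | v.wind z ≠ 0} → u.udist v = 0) →
    ∀ (X X' : unitInterval → LoopConfig ℂ),
    (∀ᵐ s : unitInterval, Regular (X s) ∧ (X s).loops ⊆ 𝒞) →
    (∀ᵐ s : unitInterval, Regular (X' s) ∧ (X' s).loops ⊆ 𝒞) →
    (∀ (i : Fin 2) (n : ℕ) (x : Fin n → ℂ) (r : Fin n → ℝ) (R : ℝ) (S : Finset (Fin n)),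
      Measurable (fun s ↦ typedPatternCount (X s) i x r R S) ∧
      Measurable (fun s ↦ typedPatternCount (X' s) i x r R S)) →
    (∀ (J : ℕ) (x : Fin J → Fin 2 → ℚ × ℚ) (r : Fin J → Fin 2 → ℚ) (R : Fin J → ℚ)
      (k : Fin J → Fin 2 → Finset (Fin 2) → ℕ), (∀ j i, 0 < r j i) → (∀ j, 0 < R j) →
      volume {s : unitInterval | ∀ j t, ∀ S : Finset (Fin 2), S.Nonempty →
        typedPatternCount (X s) t (fun i ↦ (⟨(x j i).1, (x j i).2⟩ : ℂ)) (fun i ↦ (r j i : ℝ)) (R j) S =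
          k j t S} =
      volume {s : unitInterval | ∀ j t, ∀ S : Finset (Fin 2), S.Nonempty →
        typedPatternCount (X' s) t (fun i ↦ (⟨(x j i).1, (x j i).2⟩ : ℂ)) (fun i ↦ (r j i : ℝ)) (R j) S =
          k j t S}) →
    LoopConfig.cnLawEDist volume X volume X' = 0 := by
  intro 𝒞 h𝒞 X X' hX hX' hmeas hcyl
  obtain ⟨P, h₁, h₂, hP⟩ := exists_coupling_typedCounts_eq_of_typedCylinders_eq X X' hmeas hcyl
  refine cnLawEDist_eq_zero_of_coupling P h₁ h₂ ?_
  filter_upwards [hP, ae_fst_of_map_fst_eq h₁ hX, ae_snd_of_map_snd_eq h₂ hX'] with q hq h1 h2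
  exact fun ε hε ↦ isClose_of_interiorRigid_of_typedCounts_eq h𝒞 h1.1 h2.1 h1.2 h2.2 hq ε hε.le

/-- **The whole assembly for an interior-rigid support class, conditionally on convergence of the lattice
count laws (registered anchor).**  Let `𝒞` be interior-rigid.  Let `δs → 0⁺`, bond-`ℤ²` converge in `d_CN`
to `X` and site-`𝕋` to `X'`, both presentations with a.e. `Regular` values carried by `𝒞` and measurable
typed counts, the outer exceptional events of the pair (site, `X`) measurable, the typed joint cylinder laws
agreeing on the lattice (`TypedJointNestingLawAgreement`), and the lattice typed cylinder probabilities
along `δs` converging to those of `X`, resp. `X'`.  Then `d_CN(bond_{δs k}, site_{δs k}) → 0`. -/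
theorem treeRigidity_of_interiorRigid_of_cylinderLimits : ∀ {𝒞 : Set (UnbasedLoop ℂ)},
    (∀ u ∈ 𝒞, ∀ v ∈ 𝒞, {z | u.wind z ≠ 0} = {z | v.wind z ≠ 0} → u.udist v = 0) →
    ∀ (δs : ℕ → ℝ) (X X' : unitInterval → LoopConfig ℂ), Tendsto δs atTop (𝓝[>] (0 : ℝ)) →
    Tendsto (fun k : ℕ ↦ LoopConfig.cnLawEDist zEns.P (zEns.X (δs k)) volume X) atTop (𝓝 0) →
    Tendsto (fun k : ℕ ↦ LoopConfig.cnLawEDist tEns.P (tEns.X (δs k)) volume X') atTop (𝓝 0) →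
    (∀ᵐ s : unitInterval, Regular (X s) ∧ (X s).loops ⊆ 𝒞) →
    (∀ᵐ s : unitInterval, Regular (X' s) ∧ (X' s).loops ⊆ 𝒞) →
    (∀ (i : Fin 2) (n : ℕ) (x : Fin n → ℂ) (r : Fin n → ℝ) (R : ℝ) (S : Finset (Fin n)),
      Measurable (fun s ↦ typedPatternCount (X s) i x r R S) ∧
      Measurable (fun s ↦ typedPatternCount (X' s) i x r R S)) →
    (∀ (ε : ℝ) (k : ℕ), MeasurableSet {p : tEns.Ω × unitInterval |
      LoopConfig.IsClose ε (tEns.X (δs k) p.1) (X p.2)}) →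
    TypedJointNestingLawAgreement →
    (∀ (J n : ℕ) (x : Fin J → Fin n → ℂ), ∀ᵐ p : (Fin J → Fin n → ℝ) × (Fin J → ℝ),
      (∀ j i, 0 < p.1 j i) → (∀ j, 0 < p.2 j) → ∀ k : Fin J → Fin 2 → Finset (Fin n) → ℕ,
      Tendsto (fun m : ℕ ↦ (zEns.P {ω | ∀ j t, ∀ S : Finset (Fin n), S.Nonempty →
        typedPatternCount (zEns.X (δs m) ω) t (x j) (p.1 j) (p.2 j) S = k j t S}).toReal) atTop
        (𝓝 ((volume {s : unitInterval | ∀ j t, ∀ S : Finset (Fin n), S.Nonempty →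
          typedPatternCount (X s) t (x j) (p.1 j) (p.2 j) S = k j t S}).toReal))) →
    (∀ (J n : ℕ) (x : Fin J → Fin n → ℂ), ∀ᵐ p : (Fin J → Fin n → ℝ) × (Fin J → ℝ),
      (∀ j i, 0 < p.1 j i) → (∀ j, 0 < p.2 j) → ∀ k : Fin J → Fin 2 → Finset (Fin n) → ℕ,
      Tendsto (fun m : ℕ ↦ (tEns.P {ω | ∀ j t, ∀ S : Finset (Fin n), S.Nonempty →
        typedPatternCount (tEns.X (δs m) ω) t (x j) (p.1 j) (p.2 j) S = k j t S}).toReal) atTop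
        (𝓝 ((volume {s : unitInterval | ∀ j t, ∀ S : Finset (Fin n), S.Nonempty →
          typedPatternCount (X' s) t (x j) (p.1 j) (p.2 j) S = k j t S}).toReal))) →
    Tendsto (fun k : ℕ ↦ LoopConfig.cnLawEDist zEns.P (zEns.X (δs k)) tEns.P (tEns.X (δs k)))
      atTop (𝓝 0) := by
  intro 𝒞 h𝒞 δs X X' hδs hZ hT hX hX' hmeas hclose hA hLZ hLT
  refine tendsto_cnLawEDist_zEns_tEns_of_limits δs X X' hZ hT hclose ?_
  refine cnLawEDist_eq_zero_of_interiorRigid_of_typedCylinders_eq h𝒞 X X' hX hX' hmeas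
    fun J x r R k hr hR ↦ ?_
  exact measure_typedCylinder_rat_eq_of_cylinderLimits hδs (hX.mono fun s hs ↦ hs.1.locallyFinite)
    (hX'.mono fun s hs ↦ hs.1.locallyFinite) hmeas hA hLZ hLT J x r R k hr hR

end Summit.CriticalPhenomena.CardyFormulaZ2.Cruxes.NestingRigidity.PositiveConeWeightDoubling

end
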